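import Literature.NumberTheory.Automorphic.DeligneSerreThm46bAllPairsProofs
import Literature.NumberTheory.Automorphic.DeligneSerreThm46bHolds
import HarnessLib

/-!
# Discharges of named facts of `LanglandsTunnellLSeriesProofs.lean`

`Literature/NumberTheory/Automorphic/LanglandsTunnellLSeriesProofsHolds.lean` — proofs-only
sibling of `LanglandsTunnellLSeriesProofs.lean` (no definitions, no named facts). Each theorem
below closes a named fact `X : Prop` of that file as `X_holds : X` by composing an ACCEPTED
reduction theorem of the tree with the ACCEPTED unconditional `_holds` discharges of all of
its hypotheses; nothing is re-proved and no statement is changed. Recorded by the librarian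
sweep g25 (2026-08-16, pass 5c: facts dischargeable in one line from the tree's own lemmas),
so that the facts census, `#h21_route_deps` and the cone guardrail see these facts as
theorems.

Discharged here:

* `deligneSerre_eulerPolynomial_eq_of_dvd_level_holds` :=
  `deligneSerre_eulerPolynomial_eq_of_dvd_level_of_eulerFactorAt`
  `deligneSerre_eulerFactorAt_eq_of_dvd_level_holds`
  (`DeligneSerreThm46bAllPairsProofs.lean`).

## References

* [DeligneSerreASENS1974] — see `lean/references.bib` and the docstring of the fact in `LanglandsTunnellLSeriesProofs.lean`.
-/

namespace Literature.NumberTheory.Automorphic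

/-- **Discharge of the named fact `deligneSerre_eulerPolynomial_eq_of_dvd_level`**
(`LanglandsTunnellLSeriesProofs.lean`): Deligne–Serre 1974, Thm. 4.6 (b), the local statement
at the primes dividing the level. Let `f = ∑ aₙ qⁿ ∈ S_1(Γ₁(N))` be a newform (primitive cusp
form of type `(1, ε)`) and let … — obtained as
`deligneSerre_eulerPolynomial_eq_of_dvd_level_of_eulerFactorAt` applied to the tree's
unconditional discharge `deligneSerre_eulerFactorAt_eq_of_dvd_level_holds` of its hypothesis
(reduction in `DeligneSerreThm46bAllPairsProofs.lean`).
[cite: DeligneSerreASENS1974, Thm. 4.6 (b) and its proof, step (iii)] -/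
theorem deligneSerre_eulerPolynomial_eq_of_dvd_level_holds :
    deligneSerre_eulerPolynomial_eq_of_dvd_level :=
  deligneSerre_eulerPolynomial_eq_of_dvd_level_of_eulerFactorAt
    deligneSerre_eulerFactorAt_eq_of_dvd_level_holds

end Literature.NumberTheory.Automorphic
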